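import Mathlib.AlgebraicGeometry.Morphisms.ClosedImmersion
import Mathlib.AlgebraicGeometry.IdealSheaf.Subscheme
import Mathlib.CategoryTheory.Subfunctor.Image
import HarnessLib

/-!
# A subfunctor cut out by a closed condition is represented by a closed subscheme

Topic `AlgebraicGeometry/Motives`; namespace `Literature.AlgebraicGeometry.Motives`.  THEOREMS ONLY (no definition, no
instance, no notation, no named fact, no `sorry`).  The CLOSED companion of ★ `OpenSubfunctorCover` /
`isRepresentable_of_openCondition_cover` (open conditions `Set.range h ⊆ U x`): here the condition attached to a
`T`-point `x` is an ideal sheaf `I x : T.IdealSheafData` and the membership rule is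

  `hI : F.map h.op x ∈ P(T') ↔ I x ≤ h.ker`     (`h : T' ⟶ T`; «`h` kills the ideal of the condition»),

the currency of the cell's (h6) files (★ `Morphisms/ContainmentLocusClosed`: `𝓘 ≤ (pullback.fst p b).ker`, ★
`Modules/ZeroSchemeUniversal`, `Modules/VanishingLocusOfHom.existsUnique_comp_subschemeι_eq_iff`).  If `F` is represented
by a scheme `X` (`eX : h_X ≅ F`, universal element `x₀ = eX(𝟙 X)`), then `P` is represented by the CLOSED SUBSCHEME
`V(I x₀) ↪ X` of Mathlib's `Scheme.IdealSheafData.subscheme` — the closed case of the representability criterion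
[GortzWedhorn2020, Thm. 8.9 (p. 212)] (no covering needed: one closed chart), in the form used by
[MumfordFogartyKirwan1994, Ch. 6 §3 Prop. 6.16 (p. 126)] («the closed subscheme of the base where the identity holds»).  This is the «relatively representable closed subfunctor» step of the
determinantal embedding `Hilb^P ↪ Grass` (F-DAG F-5 (5d)) and of the closed conditions of F-6 (III)/(V).

* §1 `exists_comp_subschemeι_eq_iff_le_ker`, `existsUnique_comp_subschemeι_eq_iff_le_ker` — the universal property of
  `V(J) ↪ X`: `g : T ⟶ X` factors (uniquely) through `J.subschemeι` iff `J ≤ g.ker` (Mathlib `Scheme.Hom.toImage`,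
  `IdealSheafData.inclusion`, `ker_subschemeι`, `le_ker_comp`; stated once in generic form).
* §2 for `eX : yoneda.obj X ≅ F`, `P : Subfunctor F`, `I`, `hI` as above and `x₀ := eX.hom.app (op X) (𝟙 X)`:
  **`app_mem_iff_le_ker`** (`eX f ∈ P(T) ↔ I x₀ ≤ f.ker`), **`exists_iso_yoneda_subscheme`**
  (`∃ e : h_{V(I x₀)} ≅ P` with `e.hom ≫ P.ι = h_{ι} ≫ eX.hom`), **`isRepresentable_of_closedCondition`**, and
  **`isClosedImmersion_of_closedCondition`**: for ANY representing pair `(Y, e : h_Y ≅ P)` the classifying morphism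
  `g : Y ⟶ X` (`h_g ≫ eX.hom = e.hom ≫ P.ι`) is a CLOSED IMMERSION.

Cell `hodgecm-mathlib` (D-0151), count-neutral Mathlib-side capital; nothing here is about HC — HC_CM is proved only modulo
the 7 printed citations until rung 0 closes.
-/

universe u

open CategoryTheory Opposite _root_.AlgebraicGeometry

namespace Literature.AlgebraicGeometry.Motives

/-! ## §1 The universal property of the closed subscheme `V(J) ↪ X` -/

/-- **Universal property of a closed subscheme** (existence): `g : T ⟶ X` factors through `V(J) ↪ X` iff the ideal sheaf
`J` dies under `g`, `J ≤ g.ker`. [cite: GortzWedhorn2020, Thm. 8.9 (p. 212)] [cite: Hartshorne1977, II Prop. 5.9 (PDF p. 146)] -/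
theorem exists_comp_subschemeι_eq_iff_le_ker {T X : Scheme.{u}} (J : X.IdealSheafData) (g : T ⟶ X) :
    (∃ g' : T ⟶ J.subscheme, g' ≫ J.subschemeι = g) ↔ J ≤ g.ker := by
  constructor
  · rintro ⟨g', rfl⟩
    exact (Scheme.IdealSheafData.ker_subschemeι J).ge.trans (g'.le_ker_comp _)
  · intro h
    refine ⟨g.toImage ≫ Scheme.IdealSheafData.inclusion h, ?_⟩
    rw [Category.assoc, Scheme.IdealSheafData.inclusion_subschemeι]
    exact g.toImage_imageι

/-- **Universal property of a closed subscheme** (unique factorisation; `V(J) ↪ X` is a monomorphism).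
[cite: GortzWedhorn2020, Thm. 8.9 (p. 212)] [cite: Hartshorne1977, II Prop. 5.9 (PDF p. 146)] -/
theorem existsUnique_comp_subschemeι_eq_iff_le_ker {T X : Scheme.{u}} (J : X.IdealSheafData) (g : T ⟶ X) :
    (∃! g' : T ⟶ J.subscheme, g' ≫ J.subschemeι = g) ↔ J ≤ g.ker := by
  rw [← exists_comp_subschemeι_eq_iff_le_ker J g]
  refine ⟨fun h => h.exists, fun ⟨g', hg'⟩ => ⟨g', hg', fun g'' hg'' => ?_⟩⟩
  exact (cancel_mono J.subschemeι).mp (hg''.trans hg'.symm)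

/-! ## §2 Closed conditions on a representable functor -/

section ClosedCondition

variable {F : Scheme.{u}ᵒᵖ ⥤ Type u} {X : Scheme.{u}} (eX : yoneda.obj X ≅ F) (P : Subfunctor F)
  (I : ∀ {T : Scheme.{u}}, F.obj (op T) → T.IdealSheafData)
  (hI : ∀ {T T' : Scheme.{u}} (x : F.obj (op T)) (h : T' ⟶ T), F.map h.op x ∈ P.obj (op T') ↔ I x ≤ h.ker)

/-- The value of a representing isomorphism `eX : h_X ≅ F` on `f : T ⟶ X` is the pull-back of the universal element
`x₀ = eX(𝟙 X)`: `eX f = F(f) x₀`. [folklore] -/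
private theorem app_eq_map_app_id {T : Scheme.{u}} (f : T ⟶ X) :
    eX.hom.app (op T) f = F.map f.op (eX.hom.app (op X) (𝟙 X)) := by
  have h := NatTrans.naturality_apply eX.hom f.op (𝟙 X)
  simp only [yoneda_obj_map, Quiver.Hom.unop_op] at h
  exact h

include hI in
/-- **Membership is the closed condition at the universal element**: for `f : T ⟶ X`, `eX f ∈ P(T)` iff
`I x₀ ≤ f.ker` (`x₀ = eX(𝟙 X)`). [cite: GortzWedhorn2020, Thm. 8.9 (p. 212)]
[cite: MumfordFogartyKirwan1994, Ch. 6 §3 Prop. 6.16 (p. 126)] -/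
theorem app_mem_iff_le_ker {T : Scheme.{u}} (f : T ⟶ X) :
    eX.hom.app (op T) f ∈ P.obj (op T) ↔ I (eX.hom.app (op X) (𝟙 X)) ≤ f.ker := by
  rw [app_eq_map_app_id eX f]
  exact hI _ f

include hI in
/-- **A closed condition is represented by the closed subscheme `V(I x₀) ↪ X`**: there is an isomorphism
`e : h_{V(I x₀)} ≅ P` under which the inclusion `P ↪ F ≅ h_X` is (Yoneda of) the closed immersion `V(I x₀) ↪ X`.
[cite: GortzWedhorn2020, Thm. 8.9 (p. 212)] [cite: MumfordFogartyKirwan1994, Ch. 6 §3 Prop. 6.16 (p. 126)] -/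
theorem exists_iso_yoneda_subscheme :
    ∃ e : yoneda.obj (I (eX.hom.app (op X) (𝟙 X))).subscheme ≅ P.toFunctor,
      e.hom ≫ P.ι = yoneda.map (I (eX.hom.app (op X) (𝟙 X))).subschemeι ≫ eX.hom := by
  set J := I (eX.hom.app (op X) (𝟙 X)) with hJ
  -- membership of `eX (g ≫ ι)` for every `g : T ⟶ V(J)`
  have hmem : ∀ (T : Scheme.{u}) (g : T ⟶ J.subscheme),
      eX.hom.app (op T) (g ≫ J.subschemeι) ∈ P.obj (op T) := fun T g =>
    (app_mem_iff_le_ker eX P I hI _).2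
      ((Scheme.IdealSheafData.ker_subschemeι J).ge.trans (g.le_ker_comp _))
  -- the forward natural transformation `h_{V(J)} ⟶ P`
  let φ : yoneda.obj J.subscheme ⟶ P.toFunctor :=
    Subfunctor.lift (yoneda.map J.subschemeι ≫ eX.hom) (by
      intro U y hy
      obtain ⟨T⟩ := U
      obtain ⟨g, rfl⟩ := hy
      exact hmem T g)
  have hφι : φ ≫ P.ι = yoneda.map J.subschemeι ≫ eX.hom := Subfunctor.lift_ι _ _
  -- `φ` is bijective on every `T`
  have hbij : ∀ T : Scheme.{u}ᵒᵖ, Function.Bijective (φ.app T) := by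
    rintro ⟨T⟩
    constructor
    · intro g g' hgg'
      have h1 := congrArg (fun y : P.toFunctor.obj (op T) => eX.inv.app (op T) y.1) hgg'
      have hφapp : ∀ g : T ⟶ J.subscheme, (φ.app (op T) g).1 = eX.hom.app (op T) (g ≫ J.subschemeι) :=
        fun g => rfl
      simp only [hφapp] at h1
      have h2 : g ≫ J.subschemeι = g' ≫ J.subschemeι := by
        simpa [← types_comp_apply (eX.hom.app _) (eX.inv.app _), ← NatTrans.comp_app] using h1
      exact (cancel_mono J.subschemeι).mp h2
    · rintro ⟨y, hy⟩
      have hle : J ≤ (eX.inv.app (op T) y).ker := by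
        have := (app_mem_iff_le_ker eX P I hI (eX.inv.app (op T) y)).1
        rw [← types_comp_apply (eX.inv.app _) (eX.hom.app _), ← NatTrans.comp_app, Iso.inv_hom_id,
          NatTrans.id_app, types_id_apply] at this
        exact this hy
      obtain ⟨g, hg⟩ := (exists_comp_subschemeι_eq_iff_le_ker J _).2 hle
      refine ⟨g, Subtype.ext ?_⟩
      change eX.hom.app (op T) (g ≫ J.subschemeι) = y
      rw [hg, ← types_comp_apply (eX.inv.app _) (eX.hom.app _), ← NatTrans.comp_app, Iso.inv_hom_id,
        NatTrans.id_app, types_id_apply]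
  haveI : ∀ T, IsIso (φ.app T) := fun T => (isIso_iff_bijective _).2 (hbij T)
  haveI : IsIso φ := NatIso.isIso_of_isIso_app φ
  exact ⟨asIso φ, hφι⟩

include eX hI in
/-- **A subfunctor cut out by a closed condition on a representable functor is representable.**
[cite: GortzWedhorn2020, Thm. 8.9 (p. 212)] [cite: MumfordFogartyKirwan1994, Ch. 6 §3 Prop. 6.16 (p. 126)] -/
theorem isRepresentable_of_closedCondition : P.toFunctor.IsRepresentable := by
  obtain ⟨e, -⟩ := exists_iso_yoneda_subscheme eX P I hI
  exact ⟨_, ⟨Functor.representableByEquiv.symm e⟩⟩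

include hI in
/-- **The classifying morphism of a closed condition is a closed immersion**: for ANY representing pair
`(Y, e : h_Y ≅ P)`, the morphism `g : Y ⟶ X` with `h_g ≫ eX = e ≫ (P ↪ F)` is a closed immersion (it is the closed
subscheme `V(I x₀) ↪ X` up to the isomorphism of representing objects). [cite: GortzWedhorn2020, Thm. 8.9 (p. 212)]
[cite: MumfordFogartyKirwan1994, Ch. 6 §3 Prop. 6.16 (p. 126)] -/
theorem isClosedImmersion_of_closedCondition {Y : Scheme.{u}} (e : yoneda.obj Y ≅ P.toFunctor) (g : Y ⟶ X)
    (hg : yoneda.map g ≫ eX.hom = e.hom ≫ P.ι) : IsClosedImmersion g := by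
  obtain ⟨e₀, he₀⟩ := exists_iso_yoneda_subscheme eX P I hI
  -- the isomorphism of representing objects `Y ≅ V(I x₀)`
  let ψ : Y ≅ (I (eX.hom.app (op X) (𝟙 X))).subscheme := Yoneda.fullyFaithful.preimageIso (e ≪≫ e₀.symm)
  have hψ : yoneda.map ψ.hom = e.hom ≫ e₀.inv := by
    simp only [ψ, Functor.FullyFaithful.preimageIso_hom, Functor.FullyFaithful.map_preimage, Iso.trans_hom,
      Iso.symm_hom]
  have hfac : g = ψ.hom ≫ (I (eX.hom.app (op X) (𝟙 X))).subschemeι := by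
    apply yoneda.map_injective
    apply (cancel_mono eX.hom).mp
    rw [hg, yoneda.map_comp, Category.assoc, ← he₀, hψ, Category.assoc, Iso.inv_hom_id_assoc]
  rw [hfac]
  infer_instance

end ClosedCondition

end Literature.AlgebraicGeometry.Motives
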